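import Mathlib
import Literature.Computability.Complexity.FieldElementsFromCoins
import Literature.Computability.Complexity.CoinBlockRejectionSampling
import HarnessLib

/-!
# Sampling a cubic non-residue from a coin block: the rejection probability

A randomised root finder modulo a prime `p ≡ 1 (mod 3)` (Adleman–Manders–Miller 1977) needs a cubic
NON-residue `t`: it reads a block of `μ = size p + 4` coins, reduces its value `bitsToNat` modulo `p`
and ACCEPTS `t` iff `t ≠ 0` and `t^{(p-1)/3} ≢ 1 (mod p)`.

* `uniformProb_cubicReject_le_half` — a uniform block is rejected with probability `≤ 1/2`: the
  rejected residues are `0` and the roots of `X^{(p-1)/3} - 1` (at most `(p-1)/3 + 1 ≤ (p+2)/3` of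
  them, `Polynomial.card_nthRoots`), and the reduction of a uniform `μ`-bit number modulo `p < 2^μ/16`
  is near-uniform (`CoinField.uniformProb_fieldTuple_le'`, Arora–Barak §A.2.2), so the probability is
  `≤ (p+2)/(3p) · 17/16 ≤ 1/2` for `p ≥ 7`.

Theorem-only file.

## References

* L. M. Adleman, K. L. Manders, G. L. Miller, *On taking roots in finite fields*, FOCS 1977
  [AdlemanMandersMiller1977].
* S. Arora, B. Barak, *Computational Complexity: A Modern Approach*, CUP 2009, §7.1, §A.2.2
  [AroraBarakCC2009].
-/

namespace Literature.Computability.Complexity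

open Finset BlockRejection

/-- **One coin block is rejected with probability at most `1/2`.** For a prime `p ≡ 1 (mod 3)` and
`μ = size p + 4`, the block values `v = bitsToNat z mod p` of the `z ∈ {0,1}^μ` with `v = 0` or
`v^{(p-1)/3} ≡ 1` (the non-accepted candidates: zero and the cubic residues) form a fraction `≤ 1/2`:
there are at most `(p-1)/3 + 1 ≤ (p+2)/3` such residues and the reduction of a uniform `μ`-bit number
modulo `p < 2^μ/16` is near-uniform. [cite: AroraBarakCC2009, §A.2.2] -/
theorem uniformProb_cubicReject_le_half {p : ℕ} (hp : p.Prime) (h1 : p % 3 = 1) :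
    uniformProb (p.size + 4)
      {z | ¬ (bitsToNat z % p ≠ 0 ∧ (bitsToNat z % p) ^ ((p - 1) / 3) % p ≠ 1)} ≤ 1 / 2 := by
  classical
  haveI := Fact.mk hp
  set μ := p.size + 4 with hμ
  set T := (p - 1) / 3 with hT
  have hT0 : 0 < T := by
    have h2 := hp.two_le
    have : p ≠ 4 := by rintro rfl; norm_num at hp
    omega
  set Q : (Fin 1 → ZMod p) → Prop := fun τ => τ 0 = 0 ∨ τ 0 ^ T = 1 with hQ
  set S : Set (List Bool) :=
    {w | ∃ h : w.length = 1 * μ, Q (CoinField.fieldTuple p ⟨w, h⟩)} with hS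
  have key : uniformProb (1 * μ) S ≤ _ :=
    CoinField.uniformProb_fieldTuple_le' p 1 μ Q
  have e : uniformProb (1 * μ) S = uniformProb μ S := by rw [one_mul]
  rw [e] at key
  have hsub : uniformProb μ {z | ¬ (bitsToNat z % p ≠ 0 ∧ (bitsToNat z % p) ^ T % p ≠ 1)} ≤ uniformProb μ S := by
    refine uniformProb_mono_len fun w hw hz => ?_
    have hw' : w.length = 1 * μ := by rw [one_mul]; exact hw
    refine ⟨hw', ?_⟩
    have hval : CoinField.fieldTuple p ⟨w, hw'⟩ 0 =
        ((bitsToNat w % p : ℕ) : ZMod p) := by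
      rw [CoinField.fieldTuple_apply, ZMod.natCast_mod]
      change (((bitsToNat ((w.drop ((0 : ℕ) * μ)).take μ)) : ℕ) : ZMod p) = _
      rw [zero_mul, List.drop_zero, List.take_of_length_le hw.le]
    show CoinField.fieldTuple p ⟨w, hw'⟩ 0 = 0 ∨
      CoinField.fieldTuple p ⟨w, hw'⟩ 0 ^ T = 1
    rw [hval]
    simp only [Set.mem_setOf_eq, not_and_or, not_not] at hz
    rcases hz with hz | hz
    · left
      rw [hz, Nat.cast_zero]
    · right
      have h' : (((bitsToNat w % p) ^ T % p : ℕ) : ZMod p) = ((1 : ℕ) : ZMod p) := by rw [hz]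
      rwa [ZMod.natCast_mod, Nat.cast_pow, Nat.cast_one] at h'
  refine hsub.trans (key.trans ?_)
  -- `#{Q} ≤ T + 1`
  have hcardQ : (univ.filter Q).card ≤ T + 1 := by
    have hinj : ((univ.filter Q).image fun τ : Fin 1 → ZMod p => τ 0) ⊆
        insert 0 (Polynomial.nthRoots T (1 : ZMod p)).toFinset := by
      intro x hx
      simp only [mem_image, mem_filter, mem_univ, true_and] at hx
      obtain ⟨τ, hτ, rfl⟩ := hx
      rcases hτ with h | h
      · exact mem_insert.2 (Or.inl h)
      · exact mem_insert.2 (Or.inr (Multiset.mem_toFinset.2 ((Polynomial.mem_nthRoots hT0).2 h)))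
    have hcard_img : ((univ.filter Q).image fun τ : Fin 1 → ZMod p => τ 0).card = (univ.filter Q).card := by
      refine card_image_of_injective _ fun τ τ' h => ?_
      funext i
      rw [Fin.eq_zero i]
      exact h
    rw [← hcard_img]
    refine (card_le_card hinj).trans ((card_insert_le _ _).trans ?_)
    have := (Multiset.toFinset_card_le (Polynomial.nthRoots T (1 : ZMod p))).trans
      (Polynomial.card_nthRoots T (1 : ZMod p))
    omega
  -- numerics
  have hp7 : 7 ≤ p := by
    have h2 := hp.two_le
    have : p ≠ 4 := by rintro rfl; norm_num at hp
    omega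
  have hp0 : (0 : ℝ) < p := by exact_mod_cast hp.pos
  have hT3 : (3 : ℝ) * (T + 1) ≤ p + 2 := by
    have : 3 * (T + 1) ≤ p + 2 := by omega
    exact_mod_cast this
  have hc : ((univ.filter Q).card : ℝ) ≤ T + 1 := by exact_mod_cast hcardQ
  have h16 : (16 : ℝ) * p ≤ 2 ^ μ := by
    have : 16 * p ≤ 2 ^ μ := by
      rw [hμ, pow_add]
      have := Nat.lt_size_self p
      norm_num
      omega
    exact_mod_cast this
  have h2μ : (p : ℝ) / 2 ^ μ ≤ 1 / 16 := by
    rw [div_le_div_iff₀ (by positivity) (by norm_num)]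
    linarith
  have hprod : ((univ.filter Q).card : ℝ) * (1 + (p : ℝ) / 2 ^ μ) ≤ (T + 1) * (1 + 1 / 16) :=
    mul_le_mul hc (by linarith) (by positivity) (by positivity)
  calc ((univ.filter Q).card : ℝ) / (p : ℝ) ^ 1 * (1 + (p : ℝ) / 2 ^ μ) ^ 1
      = ((univ.filter Q).card : ℝ) * (1 + (p : ℝ) / 2 ^ μ) / p := by rw [pow_one, pow_one]; ring
    _ ≤ (T + 1) * (1 + 1 / 16) / p := div_le_div_of_nonneg_right hprod hp0.le
    _ ≤ 1 / 2 := by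
        rw [div_le_iff₀ hp0]
        have hp7' : (7 : ℝ) ≤ p := by exact_mod_cast hp7
        nlinarith


end Literature.Computability.Complexity
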